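import Literature.Probability.LatticeModels.TemperleyLiebCapContract
import HarnessLib

/-!
# Two cap insertions commute with the expected index shift («TL-CAP-CAP»)

Topic `Literature/Probability/LatticeModels`; a rider on `TemperleyLiebCapContract.lean` (`skip`, `unskip`, `capIns`, `capInsL`). The last «simplicial» identity of the cup–cap
calculus used by the lane (Pearce–Rittenberg–de Gier–Nienhuis's diagrams): inserting a cap at `j` and then a cap at `i ≤ j` (in the bigger numbering) equals inserting at `i`
first and then at `j + 2`:

* `skip_skip_cap` — `skip i' (skip j z) = skip j' (skip i z)` for `i ≤ j`, `i' = i`, `j' = j + 2`;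
* ★★ `LinkPattern.capIns_capIns` — **`capIns i' (capIns j P) = capIns j' (capIns i P)`** (`i ≤ j`, `i' = i`, `j' = j+2`); linear form ★★ `capInsL_comp_capInsL`.

## References
* P. A. Pearce, V. Rittenberg, J. de Gier, B. Nienhuis, *Temperley–Lieb stochastic processes*, J. Phys. A 35 (2002) L661–L668, §2 ((monoid): the cup–cap diagrams).

## Mathlib / tree
Tree: `TemperleyLiebCapContract.lean` (`skip`, `skip_val`, `skip_injective`, `skip_ne_castSucc/succ`, `unskip`, `skip_unskip`, `capIns_partner_castSucc/succ/skip`,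
`LinkPattern.capIns`, `capInsL_single`). Mathlib: `Finsupp.lhom_ext`.
-/

namespace Literature.Probability.LatticeModels.TemperleyLieb

open Function

section CapCap

variable {n : ℕ}

/-- the double skips agree: `skip i' (skip j z) = skip j' (skip i z)` for `i ≤ j`, `i' = i`, `j' = j + 2`. [cite: PearceRittenbergDeGierNienhuis2002, §2 (link diagrams)] -/
theorem skip_skip_cap (i j : Fin (n + 1)) (i' j' : Fin (n + 1 + 1 + 1)) (hi' : i'.val = i.val) (hj' : j'.val = j.val + 2) (h : i.val ≤ j.val) (z : Fin n) :
    skip i' (skip j z) = skip j' (skip i z) := by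
  apply Fin.ext; simp only [skip_val]; split_ifs <;> omega

/-- ★★ **TWO CAP INSERTIONS COMMUTE**: `capIns i' (capIns j p) = capIns j' (capIns i p)` for `i ≤ j`, `i' = i`, `j' = j + 2` (pairings).
[cite: PearceRittenbergDeGierNienhuis2002, §2 ((monoid): the cup–cap diagrams)] -/
theorem PerfectMatching.capIns_capIns (p : PerfectMatching n) (i j : Fin (n + 1)) (i' j' : Fin (n + 1 + 1 + 1)) (hi' : i'.val = i.val) (hj' : j'.val = j.val + 2)
    (h : i.val ≤ j.val) : PerfectMatching.capIns i' (PerfectMatching.capIns j p) = PerfectMatching.capIns j' (PerfectMatching.capIns i p) := by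
  -- the four special sites in the big numbering
  have eI : Fin.castSucc i' = skip j' (Fin.castSucc i) := Fin.ext (by rw [Fin.val_castSucc, skip_val, Fin.val_castSucc]; split_ifs <;> omega)
  have eI1 : i'.succ = skip j' i.succ := Fin.ext (by rw [Fin.val_succ, skip_val, Fin.val_succ]; split_ifs <;> omega)
  have eJ : Fin.castSucc j' = skip i' (Fin.castSucc j) := Fin.ext (by rw [Fin.val_castSucc, skip_val, Fin.val_castSucc]; split_ifs <;> omega)
  have eJ1 : j'.succ = skip i' j.succ := Fin.ext (by rw [Fin.val_succ, skip_val, Fin.val_succ]; split_ifs <;> omega)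
  apply PerfectMatching.ext
  funext x
  by_cases h1 : x = Fin.castSucc i'
  · subst h1
    rw [PerfectMatching.capIns_partner_castSucc, eI, PerfectMatching.capIns_partner_skip, PerfectMatching.capIns_partner_castSucc, ← eI1]
  by_cases h2 : x = i'.succ
  · subst h2
    rw [PerfectMatching.capIns_partner_succ, eI1, PerfectMatching.capIns_partner_skip, PerfectMatching.capIns_partner_succ, ← eI]
  -- `x = skip i' y`
  obtain ⟨y, rfl⟩ : ∃ y, skip i' y = x := ⟨unskip i' x h1 h2, skip_unskip i' x h1 h2⟩
  rw [PerfectMatching.capIns_partner_skip]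
  by_cases h3 : y = Fin.castSucc j
  · subst h3
    rw [PerfectMatching.capIns_partner_castSucc, ← eJ, ← eJ1, PerfectMatching.capIns_partner_castSucc]
  by_cases h4 : y = j.succ
  · subst h4
    rw [PerfectMatching.capIns_partner_succ, ← eJ1, ← eJ, PerfectMatching.capIns_partner_succ]
  obtain ⟨z, rfl⟩ : ∃ z, skip j z = y := ⟨unskip j y h3 h4, skip_unskip j y h3 h4⟩
  rw [PerfectMatching.capIns_partner_skip, skip_skip_cap i j i' j' hi' hj' h, skip_skip_cap i j i' j' hi' hj' h, PerfectMatching.capIns_partner_skip,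
    PerfectMatching.capIns_partner_skip]

/-- ★★ **TWO CAP INSERTIONS COMMUTE** on link patterns. [cite: PearceRittenbergDeGierNienhuis2002, §2 ((monoid): the cup–cap diagrams)] -/
theorem LinkPattern.capIns_capIns (P : LinkPattern n) (i j : Fin (n + 1)) (i' j' : Fin (n + 1 + 1 + 1)) (hi' : i'.val = i.val) (hj' : j'.val = j.val + 2)
    (h : i.val ≤ j.val) : (P.capIns j).capIns i' = (P.capIns i).capIns j' :=
  Subtype.ext (PerfectMatching.capIns_capIns P.1 i j i' j' hi' hj' h)

variable {R : Type*} [CommRing R]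

/-- ★★ linear form: `capInsL i' ∘ capInsL j = capInsL j' ∘ capInsL i` (`i ≤ j`, `i' = i`, `j' = j + 2`). [cite: PearceRittenbergDeGierNienhuis2002, §2 (monoid)] -/
theorem capInsL_comp_capInsL (i j : Fin (n + 1)) (i' j' : Fin (n + 1 + 1 + 1)) (hi' : i'.val = i.val) (hj' : j'.val = j.val + 2) (h : i.val ≤ j.val) :
    capInsL R i' ∘ₗ capInsL R j (n := n) = capInsL R j' ∘ₗ capInsL R i := by
  refine Finsupp.lhom_ext fun P c => ?_
  rw [LinearMap.comp_apply, LinearMap.comp_apply, capInsL_single, capInsL_single, capInsL_single, capInsL_single, LinkPattern.capIns_capIns P i j i' j' hi' hj' h]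

end CapCap

end Literature.Probability.LatticeModels.TemperleyLieb
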